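import Mathlib
import Summits.ValiantsHypothesis.ValiantsHypothesis.Theses.ProofCarryingSymmetry
import Summits.ValiantsHypothesis.ValiantsHypothesis.Theorems.ProofCarryingSymmetryRestorationQPCosetInduction

/-!
# Route ProofCarryingSymmetry — crux `RestorationQP`, line `registered`: the induced circuit is symmetric and computes `p`

Sequel of `…RestorationQPCosetInduction` (the construction `CosetInduction.circuit`: shared inputs,
one relabelled block of the `H`-symmetric circuit `D` per left coset of `H` in `Γ`, a sum gate and
the normalised output).  Support file for the crux item `stmt-ValiantsHypothesis-10343` (lead c4,
cycle 4), third component of the coset-covering mechanism for the graded stability statements of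
the bet:

* `CosetInduction.eval_block` — block `q` computes `r_q • Ĝ` gate by gate (`r_q` the coset
  representative); `eval_sum`, `eval_output` — the sum gate computes `[Γ:H] · p` for a
  `Γ`-invariant `p = Ĝ_out`, the output `u · [Γ:H] · p = p` for `u = [Γ:H]⁻¹`;
* `CosetInduction.perm_isAutomorphismExtending`, `circuit_isSymmetric` — `γ ∈ Γ` permutes the
  cosets, `γ r_q = r_{γq} h` with `h = twist γ q ∈ H`, and block `q` goes to block `γ q` through an
  automorphism of `D` extending `h` (`Equiv.prodShear`); relays match since
  `r_{γq} • (h • ℓ) = γ • (r_q • ℓ)` on labels;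
* `CosetInduction.card_gate` and the existence statement `exists_isSymmetric_induced`:
  an `H`-symmetric circuit for a `Γ`-invariant polynomial over a field with `[Γ:H] ≠ 0` in `K`
  induces a `Γ`-symmetric one with `≤ |X| + [Γ:H]·|D| + |D| + 3` gates.

Folklore; everything proved, no named facts.
-/

-- single-problem summit: `Summit.ValiantsHypothesis.ValiantsHypothesis.…` is the namespace by design (D-0017)
set_option linter.dupNamespace false

noncomputable section

open scoped Classical Pointwise

namespace Summit.ValiantsHypothesis.ValiantsHypothesis.Theorems

namespace CosetInduction

open Literature.Computability.AlgebraicComplexity MvPolynomial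

universe u v w z

variable {K : Type u} {X : Type v} {Γ : Type w} {G₀ : Type z}

/-! ### Evaluation -/

section Eval

variable [Field K] [Group Γ] [MulAction Γ X] [Fintype Γ] [Fintype G₀]
  (H : Subgroup Γ) (D : LabelledArithCircuit K X Unit G₀) (u : K)

/-- A shared variable input evaluates to the variable. [folklore] -/
theorem eval_input_var (x : X) :
    (circuit H D u).eval (.inl (.inl (.inl x))) = MvPolynomial.X x :=
  (circuit H D u).eval_of_label_var (g := .inl (.inl (.inl x))) rfl

/-- A shared constant input evaluates to the constant. [folklore] -/
theorem eval_input_const (c : ↥(consts D u)) :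
    (circuit H D u).eval (.inl (.inl (.inr c))) = MvPolynomial.C c.1 :=
  (circuit H D u).eval_of_label_const (g := .inl (.inl (.inr c))) rfl

/-- **Block `q` computes `r_q • Ĝ` gate by gate.** [folklore] -/
theorem eval_block (q : Γ ⧸ H) (g : G₀) :
    (circuit H D u).eval (.inl (.inr (q, g))) = rename (fun x => rep H q • x) (D.eval g) := by
  induction g using D.wf.induction with
  | h g ih =>
  by_cases hin : (D.label g).IsInput
  · obtain ⟨t, ht, hw⟩ := wires_block_of_isInput H D u q hin
    have hlab : (circuit H D u).label (.inl (.inr (q, g))) = .add := by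
      rw [circuit_label]
      simp [labels, hin]
    rw [(circuit H D u).eval_of_label_add hlab]
    show ∑ h ∈ wires H D u _, _ = _
    rw [hw, Finset.sum_singleton]
    cases hg : D.label g with
    | var x =>
      rw [hg] at ht
      have htx : t = .inl (rep H q • x) := by
        simpa [inputTarget] using ht.symm
      subst htx
      rw [eval_input_var, D.eval_of_label_var hg, rename_X]
    | const c =>
      have hc : c ∈ consts D u := mem_consts_of_label D u hg
      rw [hg] at ht
      have htc : t = .inr ⟨c, hc⟩ := by
        simpa [inputTarget, hc] using ht.symm
      subst htc
      rw [eval_input_const, D.eval_of_label_const hg, rename_C]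
    | add => rw [hg] at hin; simp at hin
    | mul => rw [hg] at hin; simp at hin
  · have hw := wires_block_of_not_isInput H D u q hin
    have hlab : (circuit H D u).label (.inl (.inr (q, g))) = D.label g := by
      rw [circuit_label]
      simp [labels, hin]
    cases hg : D.label g with
    | var x => rw [hg] at hin; simp at hin
    | const c => rw [hg] at hin; simp at hin
    | add =>
      rw [hg] at hlab
      rw [(circuit H D u).eval_of_label_add hlab, D.eval_of_label_add hg, map_sum]
      show ∑ h ∈ wires H D u _, _ = _
      rw [hw, Finset.sum_map]
      exact Finset.sum_congr rfl fun h hh => ih h hh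
    | mul =>
      rw [hg] at hlab
      rw [(circuit H D u).eval_of_label_mul hlab, D.eval_of_label_mul hg, map_prod]
      show ∏ h ∈ wires H D u _, _ = _
      rw [hw, Finset.prod_map]
      exact Finset.prod_congr rfl fun h hh => ih h hh

/-- The sum gate computes `[Γ:H] · p` when `p = Ĝ_out` is `Γ`-invariant. [folklore] -/
theorem eval_sum
    (hinv : ∀ γ : Γ, rename (fun x : X => γ • x) (D.eval (D.output ())) = D.eval (D.output ())) :
    (circuit H D u).eval (.inr false) =
      MvPolynomial.C (Fintype.card (Γ ⧸ H) : K) * D.eval (D.output ()) := by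
  rw [(circuit H D u).eval_of_label_add (g := .inr false) rfl]
  show ∑ h ∈ wires H D u (.inr false), _ = _
  simp only [wires, Finset.sum_map]
  have hq : ∀ q : Γ ⧸ H, (circuit H D u).eval (outEmb H D u q) = D.eval (D.output ()) := fun q => by
    show (circuit H D u).eval (.inl (.inr (q, D.output ()))) = _
    rw [eval_block, hinv]
  rw [Finset.sum_congr rfl fun q _ => hq q, Finset.sum_const, Finset.card_univ, nsmul_eq_mul,
    MvPolynomial.C_eq_coe_nat]

/-- **The induced circuit computes `p`.** [folklore] -/
theorem eval_output
    (hinv : ∀ γ : Γ, rename (fun x : X => γ • x) (D.eval (D.output ())) = D.eval (D.output ()))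
    (hu : u * (Fintype.card (Γ ⧸ H) : K) = 1) :
    (circuit H D u).eval ((circuit H D u).output ()) = D.eval (D.output ()) := by
  show (circuit H D u).eval (.inr true) = _
  rw [(circuit H D u).eval_of_label_mul (g := .inr true) rfl]
  show ∏ h ∈ wires H D u (.inr true), _ = _
  simp only [wires]
  rw [Finset.prod_pair (by simp), eval_sum H D u hinv, eval_input_const]
  calc MvPolynomial.C (Fintype.card (Γ ⧸ H) : K) * D.eval (D.output ()) * MvPolynomial.C u
      = MvPolynomial.C (u * (Fintype.card (Γ ⧸ H) : K)) * D.eval (D.output ()) := by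
        rw [MvPolynomial.C_mul]; ring
    _ = D.eval (D.output ()) := by rw [hu, MvPolynomial.C_1, one_mul]

end Eval

/-! ### Symmetry -/

section Symmetry

variable [Group Γ] [MulAction Γ X] [Fintype G₀]

/-- The subgroup acts on labels through the ambient group. [folklore] -/
theorem subgroup_smul_label (H : Subgroup Γ) (h : ↥H) (l : CircuitLabel K X) : h • l = (h : Γ) • l := by
  cases l <;> rfl

/-- The element of `H` relating `γ r_q` and `r_{γ q}`. [folklore] -/
def twist (H : Subgroup Γ) (γ : Γ) (q : Γ ⧸ H) : ↥H :=
  ⟨(rep H (γ • q))⁻¹ * γ * rep H q, by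
    have h1 : (QuotientGroup.mk (rep H (γ • q)) : Γ ⧸ H) = QuotientGroup.mk (γ * rep H q) := by
      rw [mk_rep]
      conv_lhs => rw [← mk_rep H q]
      rfl
    have h2 := QuotientGroup.eq.1 h1
    rwa [← mul_assoc] at h2⟩

/-- `r_{γq} · twist γ q = γ · r_q`. [folklore] -/
theorem rep_smul_mul_twist (H : Subgroup Γ) (γ : Γ) (q : Γ ⧸ H) :
    rep H (γ • q) * (twist H γ q : Γ) = γ * rep H q := by
  simp [twist, mul_assoc]

variable (H : Subgroup Γ) (D : LabelledArithCircuit K X Unit G₀) (u : K)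

/-- The permutation of the gates induced by `γ` and a choice of block automorphisms. [folklore] -/
def perm (γ : Γ) (π : Γ ⧸ H → Equiv.Perm G₀) : Equiv.Perm (Gate H D u) :=
  Equiv.sumCongr
    (Equiv.sumCongr (Equiv.sumCongr (MulAction.toPerm γ) (Equiv.refl _))
      (Equiv.prodShear (MulAction.toPerm γ) π))
    (Equiv.refl Bool)

/-- The induced permutation on block gates. [folklore] -/
theorem perm_block (γ : Γ) (π : Γ ⧸ H → Equiv.Perm G₀) (q : Γ ⧸ H) (g : G₀) :
    perm H D u γ π (.inl (.inr (q, g))) = .inl (.inr (γ • q, π q g)) := rfl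

/-- The induced permutation fixes the two top gates. [folklore] -/
theorem perm_top (γ : Γ) (π : Γ ⧸ H → Equiv.Perm G₀) (b : Bool) :
    perm H D u γ π (.inr b) = .inr b := rfl

/-- The induced permutation on shared inputs: variables move by `γ`, constants are fixed. [folklore] -/
theorem perm_input (γ : Γ) (π : Γ ⧸ H → Equiv.Perm G₀) (t : X ⊕ ↥(consts D u)) :
    perm H D u γ π (.inl (.inl t)) = .inl (.inl (Sum.map (fun x => γ • x) id t)) := by
  cases t <;> rfl

/-- **The induced permutation is an automorphism extending `γ`.** [folklore] -/
theorem perm_isAutomorphismExtending [MulAction Γ Unit] [Fintype Γ] (γ : Γ) (π : Γ ⧸ H → Equiv.Perm G₀)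
    (hπ : ∀ q, D.IsAutomorphismExtending (twist H γ q) (π q)) :
    (circuit H D u).IsAutomorphismExtending γ (perm H D u γ π) := by
  -- the twisted labels of a block are carried to the twisted labels of the image block
  have hlabel : ∀ (q : Γ ⧸ H) (g : G₀),
      rep H (γ • q) • D.label (π q g) = γ • (rep H q • D.label g) := by
    intro q g
    rw [(hπ q).label_apply, subgroup_smul_label, smul_smul, rep_smul_mul_twist, mul_smul]
  have hout : ∀ q : Γ ⧸ H, π q (D.output ()) = D.output () := fun q => by
    have h := (hπ q).output_smul ()
    rw [Subsingleton.elim ((twist H γ q) • ()) ()] at h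
    exact h.symm
  refine ⟨fun s => ?_, fun s => ?_, fun _ => rfl⟩
  · -- wires
    rw [circuit_children]
    rcases s with ((t | ⟨q, g⟩) | (_ | _))
    · rw [perm_input]
      rfl
    · rw [perm_block]
      by_cases hin : (D.label g).IsInput
      · have hin' : (D.label (π q g)).IsInput := by
          rw [(hπ q).label_apply, CircuitLabel.isInput_smul]
          exact hin
        obtain ⟨t, ht, hw⟩ := wires_block_of_isInput H D u q hin
        obtain ⟨t', ht', hw'⟩ := wires_block_of_isInput H D u (γ • q) hin'
        rw [hw, hw', Finset.map_singleton]
        rw [hlabel, inputTarget_smul, ht] at ht'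
        simp only [Option.map_some, Option.some.injEq] at ht'
        rw [← ht']
        congr 1
      · have hin' : ¬ (D.label (π q g)).IsInput := by
          rw [(hπ q).label_apply, CircuitLabel.isInput_smul]
          exact hin
        rw [wires_block_of_not_isInput H D u q hin, wires_block_of_not_isInput H D u (γ • q) hin',
          (hπ q).children_apply, Finset.map_map, Finset.map_map]
        congr 1
    · rw [perm_top]
      simp only [wires, Finset.map_map]
      have hemb : (outEmb H D u).trans (perm H D u γ π).toEmbedding =
          (MulAction.toPerm γ : Equiv.Perm (Γ ⧸ H)).toEmbedding.trans (outEmb H D u) := by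
        ext q
        show perm H D u γ π (.inl (.inr (q, D.output ()))) = .inl (.inr (γ • q, D.output ()))
        rw [perm_block, hout]
      rw [hemb, ← Finset.map_map, Finset.univ_map_equiv_to_embedding]
    · rw [perm_top]
      simp only [wires, Finset.map_insert, Finset.map_singleton]
      rfl
  · -- labels
    rw [circuit_label]
    rcases s with (((x | c) | ⟨q, g⟩) | (_ | _))
    · rfl
    · rfl
    · rw [perm_block]
      simp only [labels]
      by_cases hin : (D.label g).IsInput
      · have hin' : (D.label (π q g)).IsInput := by
          rw [(hπ q).label_apply, CircuitLabel.isInput_smul]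
          exact hin
        rw [if_pos hin, if_pos hin']
        rfl
      · have hin' : ¬ (D.label (π q g)).IsInput := by
          rw [(hπ q).label_apply, CircuitLabel.isInput_smul]
          exact hin
        rw [if_neg hin, if_neg hin', (hπ q).label_apply, subgroup_smul_label]
        revert hin
        cases D.label g <;> intro hin <;> simp_all
    · rfl
    · rfl

/-- **The induced circuit is `Γ`-symmetric.** [folklore] -/
theorem circuit_isSymmetric [MulAction Γ Unit] [Fintype Γ] (hD : D.IsSymmetric ↥H) :
    (circuit H D u).IsSymmetric Γ := by
  intro γ
  choose π hπ using fun q : Γ ⧸ H => hD (twist H γ q)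
  exact ⟨perm H D u γ π, perm_isAutomorphismExtending H D u γ π hπ⟩

end Symmetry

/-! ### Size and the existence statement -/

/-- The gate count of the induced circuit. [folklore] -/
theorem card_gate [Group Γ] [Fintype Γ] [Fintype G₀] [Fintype X]
    (H : Subgroup Γ) (D : LabelledArithCircuit K X Unit G₀) (u : K) :
    Fintype.card (Gate H D u) ≤
      Fintype.card X + H.index * Fintype.card G₀ + Fintype.card G₀ + 3 := by
  have hidx : Fintype.card (Γ ⧸ H) = H.index := by
    rw [Subgroup.index, Nat.card_eq_fintype_card]
  simp only [Fintype.card_sum, Fintype.card_prod, Fintype.card_bool, Fintype.card_coe, hidx]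
  have := card_consts_le D u
  omega

end CosetInduction

open Literature.Computability.AlgebraicComplexity in
/-- **Inducing symmetric circuits from a finite-index subgroup.**  Let a finite group `Γ` act on the
variables `X` (and, trivially, on the single output index), let `H ≤ Γ`, and let `D` be an
`H`-symmetric labelled arithmetic circuit over a field `K` in which `[Γ : H] ≠ 0`, computing a
`Γ`-INVARIANT polynomial `p`.  Then some `Γ`-symmetric labelled circuit with at most
`|X| + [Γ:H]·|D| + |D| + 3` gates computes `p` (`CosetInduction.circuit`: shared inputs, one relabelled
block of `D` per coset, summed and normalised by `[Γ:H]⁻¹`). [folklore] -/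
theorem exists_isSymmetric_induced : ∀ {K : Type} [Field K] {X : Type} [Fintype X] {Γ : Type} [Group Γ] [Fintype Γ] [MulAction Γ X] [MulAction Γ Unit] (H : Subgroup Γ) {G₀ : Type} [Fintype G₀] (D : LabelledArithCircuit K X Unit G₀), D.IsSymmetric ↥H → (∀ γ : Γ, MvPolynomial.rename (fun x : X => γ • x) (D.eval (D.output ())) = D.eval (D.output ())) → (H.index : K) ≠ 0 → ∃ (G : Type) (_ : Fintype G) (E : LabelledArithCircuit K X Unit G), E.IsSymmetric Γ ∧ E.eval (E.output ()) = D.eval (D.output ()) ∧ Fintype.card G ≤ Fintype.card X + H.index * Fintype.card G₀ + Fintype.card G₀ + 3 := by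
  intro K _ X _ Γ _ _ _ _ H G₀ _ D hD hinv hidx
  classical
  have hcard : (Fintype.card (Γ ⧸ H) : K) ≠ 0 := by
    rwa [← Nat.card_eq_fintype_card, ← Subgroup.index]
  refine ⟨CosetInduction.Gate H D ((Fintype.card (Γ ⧸ H) : K)⁻¹), inferInstance,
    CosetInduction.circuit H D _, CosetInduction.circuit_isSymmetric H D _ hD,
    CosetInduction.eval_output H D _ hinv (inv_mul_cancel₀ hcard), CosetInduction.card_gate H D _⟩

end Summit.ValiantsHypothesis.ValiantsHypothesis.Theorems

end
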